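import Summits.MatrixMultiplication.MatrixMultiplication.Theorems.SaturationLadderTwinClassNoBase
import HarnessLib

/-!
# SaturationLadder — per-member facts of the STAGE-2 twin class (class form)

Route `SaturationLadder` (sub-problem `MatrixMultiplication`), crux `SubexpSaturation`
(stmt-MatrixMultiplication-25909).  For ONE member of the twin class — data `j, n₁, …, n₆ : ℕ` under
VERBATIM the hypotheses of `SaturationLadderTwinExact.omegaRect_one_tw_exact` — with saturating pair
`t = j n₁/((j+1) n₃ + n₅)`, `r = ((j+1) n₂ + n₁ + n₄)/((j+1) n₃ + n₅)`, this file records the three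
quantitative facts used by the ceiling theorems, in class form (the normalisation `n₆ = 1` of
`SaturationLadderTwinClassNoBase` is done once here, `member_normalise`):

* `member_t_le_one`:   `t ≤ 1` (every member; from the mass bound `(C1)`);
* `member_mass`:       `t ≥ 1/2 ⇒ 16 (1 − t)(j+1) ≥ 1` (`(C1)` of `SaturationLadderTwinClassCeiling`);
* `member_ceiling`:    `t ≥ 1/2`, `j ≥ 3` ⇒ `(1 − t)·log r ≥ c₂ − 320/(j+1)` (`(C2)`), `c₂ = log (3125/128)^{1/3}`;
* `member_r_pos`:      `t ≥ 1/2 ⇒ r > 0`.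

They feed the convex-hull form of the ceiling theorem (`SaturationLadderTwinHullNoBase`): saturating pairs
are a convex set by the Lotti–Romani convexity of `ω(x,y,z)`, so the honest statement of «the twin method
cannot certify `Base(θ)` below `θ_c`» must quantify over convex combinations of members, and the proof of
that statement only ever uses these per-member facts.  No definitions, no named facts, no sorry.
[cite: CoppersmithWinograd1990, §8] [cite: AlmanDuanVassilevskaWilliamsXuXuZhou2025, §3.4]
-/

set_option linter.dupNamespace false
-- (single-conjunct summit: the namespace repeats `MatrixMultiplication`)

noncomputable section

namespace Summit.MatrixMultiplication.MatrixMultiplication.Theorems.SaturationLadderTwinMember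

open Literature.Computability.AlgebraicComplexity
open Summit.MatrixMultiplication.MatrixMultiplication.Theorems.SaturationLadderTwinDefect
  (defectY_of_class defectX_of_class)
open Summit.MatrixMultiplication.MatrixMultiplication.Theorems.SaturationLadderTwinClassCeiling
  (mass_lower ceiling_ineq)
open Summit.MatrixMultiplication.MatrixMultiplication.Theorems.SaturationLadderTwinClassNoBase
  (normY normX)

/-! ### §1  Normalised form (real atoms, `n₆ = 1`) -/

/-- `t ≤ 1` for normalised data satisfying `(Y*)`, `(X*)`. [cite: AlmanDuanVassilevskaWilliamsXuXuZhou2025, §3.4] -/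
theorem norm_t_le_one (j : ℕ) {n₁ n₃ n₄ n₅ : ℝ} (h₁ : 0 ≤ n₁) (h₃ : 0 ≤ n₃) (h₄ : 0 ≤ n₄)
    (h₅ : 0 ≤ n₅) (hz : n₁ + n₄ + n₅ = 2)
    (hY : (n₃ + n₅ + 1) * Real.log (n₃ + n₅ + 1) + n₄ * Real.log n₄ - 2 * Real.log 2 ≤
      (n₃ - n₁) * (((j : ℝ) + 1) * Real.log 2 + 1))
    (hX : (n₁ + n₃) * Real.log (n₁ + n₃) + n₅ * Real.log n₅ - 2 * Real.log 2 ≤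
      (n₃ - n₄ - 1) * (((j : ℝ) + 1) * Real.log 2 + 1)) :
    (j : ℝ) * n₁ / (((j : ℝ) + 1) * n₃ + n₅) ≤ 1 := by
  have hJ0 : (0 : ℝ) < (j : ℝ) + 1 := by positivity
  have hDnn : 0 ≤ ((j : ℝ) + 1) * n₃ + n₅ := add_nonneg (mul_nonneg hJ0.le h₃) h₅
  rcases eq_or_lt_of_le hDnn with h | hD0
  · rw [← h, div_zero]; norm_num
  rcases Nat.eq_zero_or_pos j with h0 | hj1
  · subst h0; simp
  have hM := mass_lower j hj1 h₁ h₃ h₄ h₅ hz hY hX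
  rw [div_le_one hD0]
  linarith

/-- `(C1)` in ratio form: `t ≥ 1/2 ⇒ 1 ≤ 16 (1 − t)(j+1)` (normalised data).
[cite: AlmanDuanVassilevskaWilliamsXuXuZhou2025, §3.4] -/
theorem norm_mass (j : ℕ) {n₁ n₃ n₄ n₅ : ℝ} (h₁ : 0 ≤ n₁) (h₃ : 0 ≤ n₃) (h₄ : 0 ≤ n₄)
    (h₅ : 0 ≤ n₅) (hz : n₁ + n₄ + n₅ = 2)
    (hY : (n₃ + n₅ + 1) * Real.log (n₃ + n₅ + 1) + n₄ * Real.log n₄ - 2 * Real.log 2 ≤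
      (n₃ - n₁) * (((j : ℝ) + 1) * Real.log 2 + 1))
    (hX : (n₁ + n₃) * Real.log (n₁ + n₃) + n₅ * Real.log n₅ - 2 * Real.log 2 ≤
      (n₃ - n₄ - 1) * (((j : ℝ) + 1) * Real.log 2 + 1))
    (ht : 1 / 2 ≤ (j : ℝ) * n₁ / (((j : ℝ) + 1) * n₃ + n₅)) :
    1 ≤ 16 * (1 - (j : ℝ) * n₁ / (((j : ℝ) + 1) * n₃ + n₅)) * ((j : ℝ) + 1) := by
  have hJ0 : (0 : ℝ) < (j : ℝ) + 1 := by positivity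
  have hJ1 : (1 : ℝ) ≤ (j : ℝ) + 1 := by
    have : (0 : ℝ) ≤ j := Nat.cast_nonneg j; linarith
  have hDnn : 0 ≤ ((j : ℝ) + 1) * n₃ + n₅ := add_nonneg (mul_nonneg hJ0.le h₃) h₅
  have hD0 : 0 < ((j : ℝ) + 1) * n₃ + n₅ := by
    rcases eq_or_lt_of_le hDnn with h | h
    · rw [← h, div_zero] at ht; linarith
    · exact h
  have hj1 : 1 ≤ j := by
    rcases Nat.eq_zero_or_pos j with h0 | hpos
    · subst h0; simp at ht; linarith
    · exact hpos
  have ht' := ht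
  rw [le_div_iff₀ hD0] at ht'
  have htr : ((j : ℝ) + 1) * n₃ + n₅ ≤ 2 * (j : ℝ) * n₁ := by linarith only [ht']
  have hM := mass_lower j hj1 h₁ h₃ h₄ h₅ hz hY hX
  have hDu : ((j : ℝ) + 1) * n₃ + n₅ ≤ 4 * ((j : ℝ) + 1) := by
    have q0 : ((j : ℝ) + 1) * n₃ ≤ ((j : ℝ) + 1) * (2 * n₁) := by linarith only [htr, h₁, h₅]
    have q1 : 0 ≤ ((j : ℝ) + 1) * n₄ := mul_nonneg hJ0.le h₄
    have q2 : 0 ≤ ((j : ℝ) + 1) * n₅ := mul_nonneg hJ0.le h₅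
    have q3 : ((j : ℝ) + 1) * (2 * n₁) =
        4 * ((j : ℝ) + 1) - 2 * (((j : ℝ) + 1) * n₄) - 2 * (((j : ℝ) + 1) * n₅) := by
      rw [show 2 * n₁ = 4 - 2 * n₄ - 2 * n₅ by linarith only [hz]]; ring
    have q4 : n₅ ≤ ((j : ℝ) + 1) * n₅ := le_mul_of_one_le_left h₅ hJ1
    linarith only [q0, q1, q2, q3, q4]
  have h1t : 1 - (j : ℝ) * n₁ / (((j : ℝ) + 1) * n₃ + n₅) =
      (((j : ℝ) + 1) * (n₃ - n₁) + n₁ + n₅) / (((j : ℝ) + 1) * n₃ + n₅) := by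
    rw [eq_div_iff hD0.ne', sub_mul, div_mul_cancel₀ _ hD0.ne']; ring
  rw [h1t, show 16 * ((((j : ℝ) + 1) * (n₃ - n₁) + n₁ + n₅) / (((j : ℝ) + 1) * n₃ + n₅)) *
      ((j : ℝ) + 1) = 16 * (((j : ℝ) + 1) * (n₃ - n₁) + n₁ + n₅) * ((j : ℝ) + 1) /
      (((j : ℝ) + 1) * n₃ + n₅) by ring, le_div_iff₀ hD0]
  have := mul_le_mul_of_nonneg_right (show (1 : ℝ) ≤ 4 * (((j : ℝ) + 1) * (n₃ - n₁) + n₁ + n₅)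
    by linarith only [hM]) hJ0.le
  linarith only [this, hDu]

/-- `(C2)` with the regime stated as `t ≥ 1/2` (normalised data, `j ≥ 3`).
[cite: CoppersmithWinograd1990, §8] [cite: AlmanDuanVassilevskaWilliamsXuXuZhou2025, §3.4] -/
theorem norm_ceiling (j : ℕ) (hj : 3 ≤ j) {n₁ n₃ n₄ n₅ : ℝ} (h₁ : 0 ≤ n₁) (h₃ : 0 ≤ n₃)
    (h₄ : 0 ≤ n₄) (h₅ : 0 ≤ n₅) (hz : n₁ + n₄ + n₅ = 2)
    (hY : (n₃ + n₅ + 1) * Real.log (n₃ + n₅ + 1) + n₄ * Real.log n₄ - 2 * Real.log 2 ≤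
      (n₃ - n₁) * (((j : ℝ) + 1) * Real.log 2 + 1))
    (hX : (n₁ + n₃) * Real.log (n₁ + n₃) + n₅ * Real.log n₅ - 2 * Real.log 2 ≤
      (n₃ - n₄ - 1) * (((j : ℝ) + 1) * Real.log 2 + 1))
    (ht : 1 / 2 ≤ (j : ℝ) * n₁ / (((j : ℝ) + 1) * n₃ + n₅)) :
    (5 * Real.log (5 / 4) + 3 * Real.log 2) / 3 - 320 / ((j : ℝ) + 1) ≤
      (1 - (j : ℝ) * n₁ / (((j : ℝ) + 1) * n₃ + n₅)) *
        Real.log ((((j : ℝ) + 1) * ((2 : ℝ) ^ (j + 1) - n₃) + n₁ + n₄) /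
          (((j : ℝ) + 1) * n₃ + n₅)) := by
  have hJ0 : (0 : ℝ) < (j : ℝ) + 1 := by positivity
  have hDnn : 0 ≤ ((j : ℝ) + 1) * n₃ + n₅ := add_nonneg (mul_nonneg hJ0.le h₃) h₅
  have hD0 : 0 < ((j : ℝ) + 1) * n₃ + n₅ := by
    rcases eq_or_lt_of_le hDnn with h | h
    · rw [← h, div_zero] at ht; linarith
    · exact h
  have ht' := ht
  rw [le_div_iff₀ hD0] at ht'
  exact ceiling_ineq j hj h₁ h₃ h₄ h₅ hz hY hX (by linarith only [ht'])

/-! ### §2  Class form (natural counts, hypotheses of `omegaRect_one_tw_exact`) -/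

/-- Normalisation of one class member: with `nᵢ' = nᵢ/n₆`, the entropy hypotheses give `(Y*)`, `(X*)`,
the count equation gives `n₁' + n₄' + n₅' = 2`, and `t`, `r` are scale invariant (`n₂ = 2^{j+1} n₆ − n₃`).
[cite: AlmanDuanVassilevskaWilliamsXuXuZhou2025, §3.4] -/
theorem member_normalise (j n₁ n₂ n₃ n₄ n₅ n₆ : ℕ) (hn₆ : 0 < n₆)
    (hz₁ : n₁ + n₄ + n₅ = 2 * n₆) (hz₂ : n₂ + n₃ = 2 ^ (j + 1) * n₆)
    (hX : shannonEntropy ![((n₁ : ℝ) + n₄ + n₅) / (n₁ + n₂ + n₃ + n₄ + n₅ + n₆ : ℕ),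
          ((n₂ : ℝ) + n₃) / (n₁ + n₂ + n₃ + n₄ + n₅ + n₆ : ℕ),
          (n₆ : ℝ) / (n₁ + n₂ + n₃ + n₄ + n₅ + n₆ : ℕ)] ≤
        shannonEntropy ![((n₂ : ℝ) + n₄ + n₆) / (n₁ + n₂ + n₃ + n₄ + n₅ + n₆ : ℕ),
          ((n₁ : ℝ) + n₃) / (n₁ + n₂ + n₃ + n₄ + n₅ + n₆ : ℕ),
          (n₅ : ℝ) / (n₁ + n₂ + n₃ + n₄ + n₅ + n₆ : ℕ)])
    (hY : shannonEntropy ![((n₁ : ℝ) + n₄ + n₅) / (n₁ + n₂ + n₃ + n₄ + n₅ + n₆ : ℕ),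
          ((n₂ : ℝ) + n₃) / (n₁ + n₂ + n₃ + n₄ + n₅ + n₆ : ℕ),
          (n₆ : ℝ) / (n₁ + n₂ + n₃ + n₄ + n₅ + n₆ : ℕ)] ≤
        shannonEntropy ![((n₃ : ℝ) + n₅ + n₆) / (n₁ + n₂ + n₃ + n₄ + n₅ + n₆ : ℕ),
          ((n₁ : ℝ) + n₂) / (n₁ + n₂ + n₃ + n₄ + n₅ + n₆ : ℕ),
          (n₄ : ℝ) / (n₁ + n₂ + n₃ + n₄ + n₅ + n₆ : ℕ)]) :
    ((n₃ : ℝ) / n₆ + (n₅ : ℝ) / n₆ + 1) * Real.log ((n₃ : ℝ) / n₆ + (n₅ : ℝ) / n₆ + 1) +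
          (n₄ : ℝ) / n₆ * Real.log ((n₄ : ℝ) / n₆) - 2 * Real.log 2 ≤
        ((n₃ : ℝ) / n₆ - (n₁ : ℝ) / n₆) * (((j : ℝ) + 1) * Real.log 2 + 1) ∧
      ((n₁ : ℝ) / n₆ + (n₃ : ℝ) / n₆) * Real.log ((n₁ : ℝ) / n₆ + (n₃ : ℝ) / n₆) +
          (n₅ : ℝ) / n₆ * Real.log ((n₅ : ℝ) / n₆) - 2 * Real.log 2 ≤
        ((n₃ : ℝ) / n₆ - (n₄ : ℝ) / n₆ - 1) * (((j : ℝ) + 1) * Real.log 2 + 1) ∧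
      (n₁ : ℝ) / n₆ + (n₄ : ℝ) / n₆ + (n₅ : ℝ) / n₆ = 2 ∧
      (j : ℝ) * n₁ / (((j : ℝ) + 1) * n₃ + n₅) =
        (j : ℝ) * ((n₁ : ℝ) / n₆) / (((j : ℝ) + 1) * ((n₃ : ℝ) / n₆) + (n₅ : ℝ) / n₆) ∧
      (((j : ℝ) + 1) * n₂ + n₁ + n₄) / (((j : ℝ) + 1) * n₃ + n₅) =
        (((j : ℝ) + 1) * ((2 : ℝ) ^ (j + 1) - (n₃ : ℝ) / n₆) + (n₁ : ℝ) / n₆ + (n₄ : ℝ) / n₆) /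
          (((j : ℝ) + 1) * ((n₃ : ℝ) / n₆) + (n₅ : ℝ) / n₆) := by
  have hn₆' : (0 : ℝ) < n₆ := by exact_mod_cast hn₆
  have hn6ne : (n₆ : ℝ) ≠ 0 := hn₆'.ne'
  have hz₁' : (n₁ : ℝ) + n₄ + n₅ = 2 * n₆ := by exact_mod_cast hz₁
  have hz₂' : (n₂ : ℝ) + n₃ = (2 : ℝ) ^ (j + 1) * n₆ := by exact_mod_cast hz₂
  have hB : (0 : ℝ) < (2 : ℝ) ^ (j + 1) := by positivity
  push_cast at hX hY
  have hUY := defectY_of_class hB hn₆' (Nat.cast_nonneg n₁) (Nat.cast_nonneg n₂) hz₁' hz₂' hY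
  have hUX := defectX_of_class hB hn₆' (Nat.cast_nonneg n₂) (Nat.cast_nonneg n₄) hz₁' hz₂' hX
  have hYn := normY hn₆' hB (Nat.cast_nonneg n₃) (Nat.cast_nonneg n₄) (Nat.cast_nonneg n₅) hz₁' hUY
  have hXn := normX hn₆' hB (Nat.cast_nonneg n₁) (Nat.cast_nonneg n₃) (Nat.cast_nonneg n₅) hz₁' hUX
  rw [Real.log_pow] at hYn hXn
  push_cast at hYn hXn
  have ed : ((j : ℝ) + 1) * ((n₃ : ℝ) / n₆) + (n₅ : ℝ) / n₆ = (((j : ℝ) + 1) * n₃ + n₅) / n₆ := by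
    rw [add_div, mul_div_assoc]
  have hn₂ : (n₂ : ℝ) = (2 : ℝ) ^ (j + 1) * n₆ - n₃ := by linarith
  refine ⟨hYn, hXn, ?_, ?_, ?_⟩
  · rw [← add_div, ← add_div, div_eq_iff hn6ne]; linarith
  · rw [ed, ← mul_div_assoc, div_div_div_cancel_right₀ hn6ne]
  · have en : ((j : ℝ) + 1) * ((2 : ℝ) ^ (j + 1) - (n₃ : ℝ) / n₆) + (n₁ : ℝ) / n₆ + (n₄ : ℝ) / n₆ =
        (((j : ℝ) + 1) * n₂ + n₁ + n₄) / n₆ := by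
      rw [hn₂, eq_div_iff hn6ne]
      field_simp
    rw [en, ed, div_div_div_cancel_right₀ hn6ne]

/-- Every member: `t ≤ 1`. [cite: AlmanDuanVassilevskaWilliamsXuXuZhou2025, §3.4] -/
theorem member_t_le_one (j n₁ n₂ n₃ n₄ n₅ n₆ : ℕ) (hn₆ : 0 < n₆)
    (hz₁ : n₁ + n₄ + n₅ = 2 * n₆) (hz₂ : n₂ + n₃ = 2 ^ (j + 1) * n₆)
    (hX : shannonEntropy ![((n₁ : ℝ) + n₄ + n₅) / (n₁ + n₂ + n₃ + n₄ + n₅ + n₆ : ℕ),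
          ((n₂ : ℝ) + n₃) / (n₁ + n₂ + n₃ + n₄ + n₅ + n₆ : ℕ),
          (n₆ : ℝ) / (n₁ + n₂ + n₃ + n₄ + n₅ + n₆ : ℕ)] ≤
        shannonEntropy ![((n₂ : ℝ) + n₄ + n₆) / (n₁ + n₂ + n₃ + n₄ + n₅ + n₆ : ℕ),
          ((n₁ : ℝ) + n₃) / (n₁ + n₂ + n₃ + n₄ + n₅ + n₆ : ℕ),
          (n₅ : ℝ) / (n₁ + n₂ + n₃ + n₄ + n₅ + n₆ : ℕ)])
    (hY : shannonEntropy ![((n₁ : ℝ) + n₄ + n₅) / (n₁ + n₂ + n₃ + n₄ + n₅ + n₆ : ℕ),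
          ((n₂ : ℝ) + n₃) / (n₁ + n₂ + n₃ + n₄ + n₅ + n₆ : ℕ),
          (n₆ : ℝ) / (n₁ + n₂ + n₃ + n₄ + n₅ + n₆ : ℕ)] ≤
        shannonEntropy ![((n₃ : ℝ) + n₅ + n₆) / (n₁ + n₂ + n₃ + n₄ + n₅ + n₆ : ℕ),
          ((n₁ : ℝ) + n₂) / (n₁ + n₂ + n₃ + n₄ + n₅ + n₆ : ℕ),
          (n₄ : ℝ) / (n₁ + n₂ + n₃ + n₄ + n₅ + n₆ : ℕ)]) :
    (j : ℝ) * n₁ / (((j : ℝ) + 1) * n₃ + n₅) ≤ 1 := by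
  obtain ⟨hYn, hXn, hz, et, -⟩ := member_normalise j n₁ n₂ n₃ n₄ n₅ n₆ hn₆ hz₁ hz₂ hX hY
  rw [et]
  exact norm_t_le_one j (by positivity) (by positivity) (by positivity) (by positivity) hz hYn hXn

/-- Every member with `t ≥ 1/2`: `1 ≤ 16 (1 − t)(j+1)`. [cite: AlmanDuanVassilevskaWilliamsXuXuZhou2025, §3.4] -/
theorem member_mass (j n₁ n₂ n₃ n₄ n₅ n₆ : ℕ) (hn₆ : 0 < n₆)
    (hz₁ : n₁ + n₄ + n₅ = 2 * n₆) (hz₂ : n₂ + n₃ = 2 ^ (j + 1) * n₆)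
    (hX : shannonEntropy ![((n₁ : ℝ) + n₄ + n₅) / (n₁ + n₂ + n₃ + n₄ + n₅ + n₆ : ℕ),
          ((n₂ : ℝ) + n₃) / (n₁ + n₂ + n₃ + n₄ + n₅ + n₆ : ℕ),
          (n₆ : ℝ) / (n₁ + n₂ + n₃ + n₄ + n₅ + n₆ : ℕ)] ≤
        shannonEntropy ![((n₂ : ℝ) + n₄ + n₆) / (n₁ + n₂ + n₃ + n₄ + n₅ + n₆ : ℕ),
          ((n₁ : ℝ) + n₃) / (n₁ + n₂ + n₃ + n₄ + n₅ + n₆ : ℕ),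
          (n₅ : ℝ) / (n₁ + n₂ + n₃ + n₄ + n₅ + n₆ : ℕ)])
    (hY : shannonEntropy ![((n₁ : ℝ) + n₄ + n₅) / (n₁ + n₂ + n₃ + n₄ + n₅ + n₆ : ℕ),
          ((n₂ : ℝ) + n₃) / (n₁ + n₂ + n₃ + n₄ + n₅ + n₆ : ℕ),
          (n₆ : ℝ) / (n₁ + n₂ + n₃ + n₄ + n₅ + n₆ : ℕ)] ≤
        shannonEntropy ![((n₃ : ℝ) + n₅ + n₆) / (n₁ + n₂ + n₃ + n₄ + n₅ + n₆ : ℕ),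
          ((n₁ : ℝ) + n₂) / (n₁ + n₂ + n₃ + n₄ + n₅ + n₆ : ℕ),
          (n₄ : ℝ) / (n₁ + n₂ + n₃ + n₄ + n₅ + n₆ : ℕ)])
    (ht : 1 / 2 ≤ (j : ℝ) * n₁ / (((j : ℝ) + 1) * n₃ + n₅)) :
    1 ≤ 16 * (1 - (j : ℝ) * n₁ / (((j : ℝ) + 1) * n₃ + n₅)) * ((j : ℝ) + 1) := by
  obtain ⟨hYn, hXn, hz, et, -⟩ := member_normalise j n₁ n₂ n₃ n₄ n₅ n₆ hn₆ hz₁ hz₂ hX hY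
  rw [et] at ht ⊢
  exact norm_mass j (by positivity) (by positivity) (by positivity) (by positivity) hz hYn hXn ht

/-- Every member with `t ≥ 1/2`, `j ≥ 3`: `(1 − t) log r ≥ c₂ − 320/(j+1)`.
[cite: CoppersmithWinograd1990, §8] [cite: AlmanDuanVassilevskaWilliamsXuXuZhou2025, §3.4] -/
theorem member_ceiling (j n₁ n₂ n₃ n₄ n₅ n₆ : ℕ) (hj : 3 ≤ j) (hn₆ : 0 < n₆)
    (hz₁ : n₁ + n₄ + n₅ = 2 * n₆) (hz₂ : n₂ + n₃ = 2 ^ (j + 1) * n₆)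
    (hX : shannonEntropy ![((n₁ : ℝ) + n₄ + n₅) / (n₁ + n₂ + n₃ + n₄ + n₅ + n₆ : ℕ),
          ((n₂ : ℝ) + n₃) / (n₁ + n₂ + n₃ + n₄ + n₅ + n₆ : ℕ),
          (n₆ : ℝ) / (n₁ + n₂ + n₃ + n₄ + n₅ + n₆ : ℕ)] ≤
        shannonEntropy ![((n₂ : ℝ) + n₄ + n₆) / (n₁ + n₂ + n₃ + n₄ + n₅ + n₆ : ℕ),
          ((n₁ : ℝ) + n₃) / (n₁ + n₂ + n₃ + n₄ + n₅ + n₆ : ℕ),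
          (n₅ : ℝ) / (n₁ + n₂ + n₃ + n₄ + n₅ + n₆ : ℕ)])
    (hY : shannonEntropy ![((n₁ : ℝ) + n₄ + n₅) / (n₁ + n₂ + n₃ + n₄ + n₅ + n₆ : ℕ),
          ((n₂ : ℝ) + n₃) / (n₁ + n₂ + n₃ + n₄ + n₅ + n₆ : ℕ),
          (n₆ : ℝ) / (n₁ + n₂ + n₃ + n₄ + n₅ + n₆ : ℕ)] ≤
        shannonEntropy ![((n₃ : ℝ) + n₅ + n₆) / (n₁ + n₂ + n₃ + n₄ + n₅ + n₆ : ℕ),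
          ((n₁ : ℝ) + n₂) / (n₁ + n₂ + n₃ + n₄ + n₅ + n₆ : ℕ),
          (n₄ : ℝ) / (n₁ + n₂ + n₃ + n₄ + n₅ + n₆ : ℕ)])
    (ht : 1 / 2 ≤ (j : ℝ) * n₁ / (((j : ℝ) + 1) * n₃ + n₅)) :
    (5 * Real.log (5 / 4) + 3 * Real.log 2) / 3 - 320 / ((j : ℝ) + 1) ≤
      (1 - (j : ℝ) * n₁ / (((j : ℝ) + 1) * n₃ + n₅)) *
        Real.log ((((j : ℝ) + 1) * n₂ + n₁ + n₄) / (((j : ℝ) + 1) * n₃ + n₅)) := by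
  obtain ⟨hYn, hXn, hz, et, er⟩ := member_normalise j n₁ n₂ n₃ n₄ n₅ n₆ hn₆ hz₁ hz₂ hX hY
  rw [et] at ht ⊢
  rw [er]
  exact norm_ceiling j hj (by positivity) (by positivity) (by positivity) (by positivity) hz hYn
    hXn ht

/-- Every member with `t ≥ 1/2`: `r > 0` (indeed `n₁ > 0`). [folklore] -/
theorem member_r_pos (j n₁ n₂ n₃ n₄ n₅ : ℕ)
    (ht : 1 / 2 ≤ (j : ℝ) * n₁ / (((j : ℝ) + 1) * n₃ + n₅)) :
    0 < (((j : ℝ) + 1) * n₂ + n₁ + n₄) / (((j : ℝ) + 1) * n₃ + n₅) := by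
  have hDnn : (0 : ℝ) ≤ ((j : ℝ) + 1) * n₃ + n₅ := by positivity
  have hD0 : (0 : ℝ) < ((j : ℝ) + 1) * n₃ + n₅ := by
    rcases eq_or_lt_of_le hDnn with h | h
    · rw [← h, div_zero] at ht; linarith
    · exact h
  have hn₁ : (0 : ℝ) < n₁ := by
    have ht' := ht
    rw [le_div_iff₀ hD0] at ht'
    have h0 : (0 : ℝ) < (j : ℝ) * n₁ := by linarith
    rcases Nat.eq_zero_or_pos n₁ with h | h
    · subst h; simp at h0
    · exact_mod_cast h
  apply div_pos _ hD0
  positivity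

end Summit.MatrixMultiplication.MatrixMultiplication.Theorems.SaturationLadderTwinMember
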